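import Mathlib.Analysis.Complex.IsIntegral
import Literature.NumberTheory.NumberFields.WeilNumberCMField
import Literature.NumberTheory.ComplexMultiplication.PrimitiveCMPairsClassification
import HarnessLib

/-!
# Milne 1999 §4: Weil `pⁿ`-numbers of weight `−m`, the groups `W(pⁿ)` inside `ℚ^{cm}` with their `Γ`-action and weights,
# «`ℚ[π]` is a CM-field or totally real», the transition maps `π ↦ π^{n′/n}`, and `W_{1,+}(pⁿ)`
# (J. S. Milne, *Lefschetz motives and the Tate conjecture*, Compositio Math. 117 (1999) §4 pp. 59–60)

Family `hodge`, lane `lit-hodgefound` (Layer A3; seat `lit-hodgefound-p27`, generation 15, row g15-#2); topic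
`Literature/NumberTheory/ComplexMultiplication`, namespace `Literature.NumberTheory.ComplexMultiplication.CMNumbers` (the
`ℚ^{cm}` objects, as in the seat's Serre-group files and Q731's `torusChar`).  FIRST FILE of the FINITE-LEVEL half of
Milne 1999 §4's «Weil numbers and abelian varieties»: the GROUPS `W(pⁿ)` (DAG-B node B5-09: «no Honda–Tate record in
`Literature/` … Thm 4.3 / 5.4 / 6.1 absent»; the Weil-number torus `P` with `X^*(P) = W(p^∞)` is the object of Milne's
`P = L ∩ S`).  Sequel of the tree's `NumberFields/WeilNumberCMField.lean` (Waterhouse 1969 Ch. 2 / Tate 1968: a Weil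
`q`-number of weight `−1` in `ℂ` is a CM number, `WeilNumber.mem_cmNumbers`; `ℚ(π)` is totally real or CM) and of
`NumberFields/CMNumbers.lean` (`ℚ^{cm} = cmNumbers ⊂ ℂ`, `Γ = Gal(ℚ^{cm}/ℚ)`, `ι = cmNumbersConj`).  Small carriers with bodies
(`IsWeilNumber`, `weilGroup`, `weilExp`/`weilExpHom`, `weilAct`/`weilRep`, `weilTransition`, `weilOnePlus`) + THEOREMS; no named
fact (D-0026, net debt 0).

THE PRINT.  [Milne1999] §4 pp. 59–60 (held `paper:doi-10-1023-a-1000776613765` p0015 L22–L31, p0016 L1–L12), verbatim: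
«In this section, `ℚ^{al}` is the algebraic closure of `ℚ` in `ℂ`.  WEIL NUMBERS AND ABELIAN VARIETIES.  Let `p` be a prime
number. An element `π` of a field algebraic over `ℚ` is said to be a Weil `pⁿ`-number of weight `−m` if (a) for all
embeddings `ρ : ℚ[π] ↪ ℂ`, `ρ(π)·ιρ(π) = (pⁿ)^m`; (b) for some `N`, `p^N π` is an algebraic integer.  Condition (a) implies
that `π ↦ p^{nm}/π` defines an involution (possibly trivial) `ι′` of `ℚ[π]` such that `ρ ∘ ι′ = ι ∘ ρ` for all embeddings
`ρ : ℚ[π] ↪ ℂ`. Therefore `ℚ[π]` is either a CM-field or is totally real.  Let `W(pⁿ)` be the group of Weil `pⁿ`-numbers in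
`ℚ^{al}`. If `n | n′`, then `π ↦ π^{n′/n}` maps `W(pⁿ)` into `W(p^{n′})`, and we define `W(p^∞) = lim→_n W(pⁿ)`. … There is a
natural action of `Γ` on `W(p^∞)`, and the Weil-number torus `P` is defined to be the pro-torus over `ℚ` with
`X^*(P) = W(p^∞)`.  Let `W_{1,+}(pⁿ)` be the subset of `W(pⁿ)` consisting of those `π` that are of weight `−1` and are
algebraic integers, and let `W_{1,+}(p^∞) = lim→ W_{1,+}(pⁿ)`.»

DICTIONARY.  Milne's `Γ = Gal(ℚ^{al}/ℚ)`, `ι` = complex conjugation.  By the printed remark («`ℚ[π]` is either a CM-field or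
is totally real») every Weil number of `ℚ^{al} ⊂ ℂ` lies in `ℚ^{cm} = cmNumbers` — the union of the CM subfields of `ℚ^{al}`,
which also contains the totally real ones (`NumberFields.le_cmNumbers`); this is PROVED here for all weights
(`mem_cmNumbers_of_forall_mul_conj_eq`, extending the tree's weight-`−1` `WeilNumber.mem_cmNumbers`).  So `W(pⁿ)` is
modelled INSIDE `ℚ^{cm}`: `IsWeilNumber p n m π` for `π : cmNumbers`, with (a) quantified over `Γ_{cm} = Gal(ℚ^{cm}/ℚ) =
(cmNumbers ≃ₐ[ℚ] cmNumbers)` — through which `Gal(ℚ^{al}/ℚ)` acts (the embeddings `ℚ[π] ↪ ℂ` are the `σ|_{ℚ[π]}`,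
`σ ∈ Γ_{cm}`, since `ℚ^{cm}/ℚ` is Galois) — and, because `ι` is CENTRAL in `Γ_{cm}` (`cmNumbersConj_comm`), (a) is
EQUIVALENT to the single equation `π · ιπ = (pⁿ)^m` (`isWeilNumber_iff`).  `W(pⁿ) = weilGroup p n ≤ (ℚ^{cm})ˣ`; the weight
is the integer `m` of (a) (`weilExp`, unique once `pⁿ > 1`), Milne's «weight» being `−m`.

WHAT IS HERE (all PROVED):
* §1 DEF **`IsWeilNumber p n m π`** ((a) over `Γ_{cm}` + (b)); **`isWeilNumber_iff`** ((a) ⟺ the one equation `π·ιπ = (pⁿ)^m`);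
  `IsWeilNumber.ne_zero`, **`.conj_eq_div`** («`π ↦ p^{nm}/π` defines an involution `ι′` … `ρ ∘ ι′ = ι ∘ ρ`»: on `ℚ^{cm}` the
  involution `ι′` IS complex conjugation), `.coe_mul_conj` / `.norm_coe_sq` (`|π|² = (pⁿ)^m` in `ℂ`), **`.unique`** (the weight
  is determined once `pⁿ > 1`), `.one`, **`.mul`** (weights add), **`.inv`**, `.conj`, **`.smul`** (`Γ`-conjugates), `.pow`,
  **`.pow_level`** (`π^k ∈ W(p^{nk})` with the SAME weight), `.of_pow_eq_one` (roots of unity: weight `0`), `.natCast_pow` (`pⁿ ∈ W(pⁿ)`,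
  weight `−2`), `.natCast_prime_sq` (`p ∈ W(p²)`, weight `−1`); **`mem_cmNumbers_of_forall_mul_conj_eq`** («Therefore `ℚ[π]` is
  either a CM-field or is totally real» ⟹ `π ∈ ℚ^{cm}` — ALL weights, for `π ∈ ℂ` algebraic with `σ(π)·\overline{σ(π)} = (pⁿ)^m`
  for every `σ ∈ Aut(ℂ)`), `isTotallyReal_or_isCMField_adjoin` (the printed sentence), `isWeilNumber_of_forall_ringEquiv` (such a
  `π ∈ ℂ`, with (b), IS a Weil `pⁿ`-number of `ℚ^{cm}` — the passage from Milne's `W(pⁿ) ⊂ ℚ^{al}` to this carrier).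
* §2 DEF **`weilGroup p n : Subgroup (ℚ^{cm})ˣ = W(pⁿ)`** («the group of Weil `pⁿ`-numbers»), `mem_weilGroup_iff`,
  `weilGroup.ofIsWeilNumber`; DEF `weilExp u` (the `m`; `isWeilNumber_weilExp`, **`weilExp_eq`** for `n ≠ 0`), `weilExp_mul`/`_one`/`_inv`,
  DEF **`weilExpHom p n : W(pⁿ) →* Multiplicative ℤ`** (the weight homomorphism; non-trivial, `weilExpHom_ne_one`); the `Γ`-ACTION:
  `map_mem_weilGroup`, DEF **`weilAct p n σ : W(pⁿ) →* W(pⁿ)`** (`coe_weilAct`, `weilAct_one`, `weilAct_mul`), DEF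
  **`weilRep p n : Representation ℤ Γ (Additive W(pⁿ))`** («a natural action of `Γ`» — the shape consumed by the tree's `torusPoints`),
  **`weilExp_weilAct`** (weights are `Γ`-invariant), **`coe_weilAct_cmNumbersConj`** (`ι` acts as `u ↦ (pⁿ)^m u⁻¹`).
* §3 THE TRANSITION MAPS: `pow_mem_weilGroup_mul`, DEF **`weilTransition (h : n ∣ n′) : W(pⁿ) →* W(p^{n′})`, `π ↦ π^{n′/n}`** («if
  `n | n′`, then `π ↦ π^{n′/n}` maps `W(pⁿ)` into `W(p^{n′})`»), `coe_weilTransition`, **`weilExp_weilTransition`** (weight preserved),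
  **`weilTransition_weilAct`** (`Γ`-equivariant), **`weilTransition_refl` / `weilTransition_trans`** (a DIRECTED SYSTEM along
  divisibility — the system whose limit is `W(p^∞)`), `weilTransition_eq_weilTransition_iff` (`u ∈ W(pⁿ)`, `u′ ∈ W(p^{n′})` agree in
  `W(p^{nn′})` iff `u^{n′} = u′^{n}` — the printed relation, before roots of unity enter at the limit).
* §4 DEF **`weilOnePlus p n = W_{1,+}(pⁿ) ⊆ W(pⁿ)`** (weight `−1` AND an algebraic integer), `mem_weilOnePlus_iff`,
  `weilExp_eq_one_of_mem_weilOnePlus`, **`weilAct_mem_weilOnePlus`** (`Γ`-stable), **`weilTransition_mem_weilOnePlus`** («`W_{1,+}(p^∞) =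
  lim→ W_{1,+}(pⁿ)`»); a weight-`−1` Weil `pⁿ`-number is one in the sense of the tree's `WeilNumber` file —
  `norm_ringEquiv_eq_sqrt_of_isWeilNumber_one` (`‖σ π‖ = √(pⁿ)` for EVERY `σ ∈ Aut(ℂ)`, via `CMNumbers.galRestrict`) — so Waterhouse's
  structure theory applies BY NAME: `isTotallyReal_or_isCMField_adjoin_of_isWeilNumber_one`, `isCMField_adjoin_iff_of_isWeilNumber_one`
  (`ℚ(π)` is CM iff `π² ≠ pⁿ`).
* §5 VALIDATION: **`isWeilNumber_one_add_two_mul_I`** — `1 + 2i` is a Weil `5`-number of weight `−1` (`(1+2i)(1−2i) = 5`),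
  `one_add_two_mul_I_mem_weilOnePlus` (`1 + 2i ∈ W_{1,+}(5)`), `isCMField_adjoin_one_add_two_mul_I` (`ℚ(1+2i)` is CM — a non-real
  Weil number), `natCast_mem_weilOnePlus_two` (`p ∈ W_{1,+}(p²)`, the supersingular Weil number), `natCast_pow_mem_weilGroup`
  (`pⁿ ∈ W(pⁿ)`), `mem_weilGroup_of_pow_eq_one` (roots of unity), `weilExpHom_ne_one`.

NOT here (next file, g15-#3): `W(p^∞) = lim→ W(pⁿ)` and `[π]`, the Weil-number pro-torus `P` (`X^*(P) = W(p^∞)`) through its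
character module and points, the tori `L^Π` of `Γ`-orbits `Π ⊂ W_{1,+}(p^∞)` and Lemma 4.2; Prop. 4.1 / Thm. 4.3 (Honda–Tate,
Lefschetz motives over `𝔽` — Layer B, B5-09).

## References

* [Milne1999] J. S. Milne, *Lefschetz motives and the Tate conjecture*, Compositio Math. 117 (1999) 45–76 — §4 «Weil numbers
  and abelian varieties», pp. 59–60 (held `paper:doi-10-1023-a-1000776613765` p0015 L22–L31, p0016 L1–L12).
* [Waterhouse1969] W. C. Waterhouse, *Abelian varieties over finite fields*, Ann. sci. ÉNS (4) 2 (1969), Ch. 2 pp. 527–528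
  (through the tree's `NumberFields/WeilNumberCMField.lean`).
* [MilneCM2006] J. S. Milne, *Complex Multiplication* (course notes), Ch. I §1 Rem. 1.6 (p. 10) (`ℚ^{cm}`; the tree's
  `NumberFields/CMNumbers.lean`).
* [MilneShih1982Taniyama] J. S. Milne, K.-y. Shih, LNM 900 (1982) art. III §1 (1.4) p. 232 («`ℚ^{cm}` … the largest subfield
  on which `ι` and `σ` commute»).

Provenance: lane `lit-hodgefound`, seat `lit-hodgefound-p27` gen 15 (agent `literature-prover-lit-hodgefound-p27-g15-0`),
row g15-#2 (INBOX 2026-08-23T00:14:55Z l.5535).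
-/

set_option autoImplicit false

noncomputable section

open scoped ComplexConjugate IntermediateField

namespace Literature.NumberTheory.ComplexMultiplication

namespace CMNumbers

open Literature.NumberTheory.NumberFields (cmNumbers cmNumbersConj coe_cmNumbersConj cmNumbersConj_comm
  cmNumbersConj_mul_self cmNumbersConj_cmNumbersConj I_mem_cmNumbers mem_cmNumbers_iff_conj_comm map_mem_cmNumbers
  mem_cmNumbers_iff_adjoin isAlgebraic_of_mem_cmNumbers)

variable {p n : ℕ} {m : ℤ} {π : cmNumbers}

/-! ### §1 Weil `pⁿ`-numbers of weight `−m` in `ℚ^{cm}` -/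

/-- **A Weil `pⁿ`-number of weight `−m`** (in `ℚ^{cm} ⊂ ℂ`): «(a) for all embeddings `ρ : ℚ[π] ↪ ℂ`, `ρ(π)·ιρ(π) = (pⁿ)^m`»
— the embeddings being the restrictions of the `σ ∈ Γ = Gal(ℚ^{cm}/ℚ)` — «(b) for some `N`, `p^N π` is an algebraic integer».
[cite: Milne1999, §4 p. 59 L25–L28] -/
structure IsWeilNumber (p n : ℕ) (m : ℤ) (π : cmNumbers) : Prop where
  /-- (a) `ρ(π)·ιρ(π) = (pⁿ)^m` for every conjugate `ρ(π) = σπ`. -/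
  mul_conj : ∀ σ : cmNumbers ≃ₐ[ℚ] cmNumbers, σ π * cmNumbersConj (σ π) = ((p : cmNumbers) ^ n) ^ m
  /-- (b) `p^N π` is an algebraic integer for some `N`. -/
  exists_isIntegral : ∃ N : ℕ, IsIntegral ℤ ((p : cmNumbers) ^ N * π)

/-- `σ(π·ιπ) = σπ · ι(σπ)` — complex conjugation is central in `Γ`. [cite: MilneCM2006, Ch. I §1 Rem. 1.6 (p. 10)] -/
theorem map_mul_cmNumbersConj (σ : cmNumbers ≃ₐ[ℚ] cmNumbers) (π : cmNumbers) :
    σ (π * cmNumbersConj π) = σ π * cmNumbersConj (σ π) := by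
  rw [map_mul, cmNumbersConj_comm]

/-- **(a) is ONE equation in `ℚ^{cm}`: `IsWeilNumber p n m π ↔ π·ιπ = (pⁿ)^m ∧ (b)`** — because `σ(π·ιπ) = σπ·ι(σπ)` and `σ`
fixes the rational number `(pⁿ)^m` («the largest subfield on which `ι` and `σ` commute»).
[cite: Milne1999, §4 p. 59 L25–L28] [cite: MilneShih1982Taniyama, III §1 (1.4) (p. 232)] -/
theorem isWeilNumber_iff : IsWeilNumber p n m π ↔
    π * cmNumbersConj π = ((p : cmNumbers) ^ n) ^ m ∧ ∃ N : ℕ, IsIntegral ℤ ((p : cmNumbers) ^ N * π) := by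
  constructor
  · exact fun h => ⟨by simpa using h.mul_conj 1, h.exists_isIntegral⟩
  · rintro ⟨ha, hb⟩
    refine ⟨fun σ => ?_, hb⟩
    rw [← map_mul_cmNumbersConj, ha, map_zpow₀, map_pow, map_natCast]

/-- The defining equation at the given embedding: `π·ιπ = (pⁿ)^m`. [cite: Milne1999, §4 p. 59 L25–L27] -/
theorem IsWeilNumber.mul_conj_self (h : IsWeilNumber p n m π) : π * cmNumbersConj π = ((p : cmNumbers) ^ n) ^ m :=
  (isWeilNumber_iff.mp h).1

/-- In `ℂ`: `π · π̄ = (pⁿ)^m`. [cite: Milne1999, §4 p. 59 L25–L27] -/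
theorem IsWeilNumber.coe_mul_conj (h : IsWeilNumber p n m π) : (π : ℂ) * conj (π : ℂ) = ((p : ℂ) ^ n) ^ m := by
  have h1 := congrArg (algebraMap cmNumbers ℂ) h.mul_conj_self
  rw [map_mul, map_zpow₀, map_pow, map_natCast] at h1
  exact h1

/-- A Weil number is non-zero (for a prime, indeed any non-zero, `p`). [cite: Milne1999, §4 p. 59 L25–L28] -/
theorem IsWeilNumber.ne_zero (hp : p ≠ 0) (h : IsWeilNumber p n m π) : π ≠ 0 := by
  intro h0
  have h1 := h.mul_conj_self
  rw [h0, zero_mul] at h1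
  exact (zpow_ne_zero m (pow_ne_zero n (Nat.cast_ne_zero.mpr hp))) h1.symm

/-- **«Condition (a) implies that `π ↦ p^{nm}/π` defines an involution `ι′` of `ℚ[π]` such that `ρ ∘ ι′ = ι ∘ ρ`»** — inside
`ℚ^{cm}` the involution `ι′` is complex conjugation itself: `ιπ = (pⁿ)^m / π`. [cite: Milne1999, §4 p. 59 L28–L30] -/
theorem IsWeilNumber.conj_eq_div (hp : p ≠ 0) (h : IsWeilNumber p n m π) :
    cmNumbersConj π = ((p : cmNumbers) ^ n) ^ m / π := by
  rw [eq_div_iff (h.ne_zero hp), mul_comm]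
  exact h.mul_conj_self

/-- `|π|² = (pⁿ)^m` in `ℂ` (norm form of (a)). [cite: Milne1999, §4 p. 59 L25–L27] -/
theorem IsWeilNumber.norm_coe_sq (h : IsWeilNumber p n m π) : ‖(π : ℂ)‖ ^ 2 = ((p : ℝ) ^ n) ^ m := by
  have h1 : ((‖(π : ℂ)‖ : ℂ) ^ 2) = (((p : ℝ) : ℂ) ^ n) ^ m := by
    rw [← Complex.mul_conj', h.coe_mul_conj, Complex.ofReal_natCast]
  exact_mod_cast h1

/-- **The weight is well defined**: `(pⁿ)^m = (pⁿ)^{m′}` forces `m = m′` once `pⁿ > 1`. [cite: Milne1999, §4 p. 59 L25–L27] -/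
theorem IsWeilNumber.unique (hp : 1 < p) (hn : n ≠ 0) {m m' : ℤ} (h : IsWeilNumber p n m π) (h' : IsWeilNumber p n m' π) :
    m = m' := by
  have h1 : ((p : ℝ) ^ n) ^ m = ((p : ℝ) ^ n) ^ m' := by rw [← h.norm_coe_sq, ← h'.norm_coe_sq]
  have hq1 : (1 : ℝ) < (p : ℝ) ^ n := one_lt_pow₀ (by exact_mod_cast hp) hn
  exact (zpow_right_injective₀ (lt_trans zero_lt_one hq1) hq1.ne') h1

/-- `1 ∈ W(pⁿ)` has weight `0`. [cite: Milne1999, §4 p. 59 L31 («the group of Weil pⁿ-numbers»)] -/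
theorem IsWeilNumber.one : IsWeilNumber p n 0 (1 : cmNumbers) :=
  isWeilNumber_iff.mpr ⟨by rw [map_one, mul_one, zpow_zero], 0, by rw [pow_zero, mul_one]; exact isIntegral_one⟩

/-- **Weights add: `π π′` is a Weil `pⁿ`-number of weight `−(m + m′)`** («the group of Weil `pⁿ`-numbers»).
[cite: Milne1999, §4 p. 59 L31] -/
theorem IsWeilNumber.mul (hp : p ≠ 0) {m' : ℤ} {π' : cmNumbers} (h : IsWeilNumber p n m π) (h' : IsWeilNumber p n m' π') :
    IsWeilNumber p n (m + m') (π * π') := by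
  obtain ⟨N, hN⟩ := h.exists_isIntegral
  obtain ⟨N', hN'⟩ := h'.exists_isIntegral
  refine isWeilNumber_iff.mpr ⟨?_, N + N', ?_⟩
  · rw [map_mul, mul_mul_mul_comm, h.mul_conj_self, h'.mul_conj_self,
      ← zpow_add₀ (pow_ne_zero n (Nat.cast_ne_zero.mpr hp))]
  · have : (p : cmNumbers) ^ (N + N') * (π * π') = ((p : cmNumbers) ^ N * π) * ((p : cmNumbers) ^ N' * π') := by ring
    rw [this]
    exact hN.mul hN'

/-- `ι` maps algebraic integers of `ℚ^{cm}` to algebraic integers (it is a ring automorphism). [cite: MilneCM2006, Ch. I §1 Rem. 1.6 (p. 10)] -/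
theorem isIntegral_cmNumbersConj {x : cmNumbers} (hx : IsIntegral ℤ x) : IsIntegral ℤ (cmNumbersConj x) :=
  map_isIntegral_int (cmNumbersConj : cmNumbers ≃ₐ[ℚ] cmNumbers).toAlgHom.toRingHom hx

/-- Condition (b) «`p^N π` is an algebraic integer» may be read in `ℚ^{cm}` or in `ℂ`: integrality over `ℤ` of an element of
`ℚ^{cm}` is integrality of the complex number (the inclusion is injective). [cite: Milne1999, §4 p. 59 L27–L28 («(b) for some N, p^N π is an algebraic integer»)] -/
theorem isIntegral_iff_coe (x : cmNumbers) : IsIntegral ℤ x ↔ IsIntegral ℤ (x : ℂ) :=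
  (isIntegral_algHom_iff (cmNumbers.val : cmNumbers →ₐ[ℚ] ℂ).toRingHom.toIntAlgHom Subtype.val_injective).symm

/-- **`ιπ` is a Weil `pⁿ`-number of the same weight.** [cite: Milne1999, §4 p. 59 L28–L31] -/
theorem IsWeilNumber.conj (h : IsWeilNumber p n m π) : IsWeilNumber p n m (cmNumbersConj π) := by
  obtain ⟨N, hN⟩ := h.exists_isIntegral
  refine isWeilNumber_iff.mpr ⟨by rw [cmNumbersConj_cmNumbersConj, mul_comm, h.mul_conj_self], N, ?_⟩
  have h1 := isIntegral_cmNumbersConj hN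
  rwa [map_mul, map_pow, map_natCast] at h1

/-- **The `Γ`-conjugates `σπ` are Weil `pⁿ`-numbers of the same weight** («There is a natural action of `Γ`»).
[cite: Milne1999, §4 p. 60 L8–L9] -/
theorem IsWeilNumber.smul (σ : cmNumbers ≃ₐ[ℚ] cmNumbers) (h : IsWeilNumber p n m π) : IsWeilNumber p n m (σ π) := by
  obtain ⟨N, hN⟩ := h.exists_isIntegral
  refine ⟨fun τ => by rw [← AlgEquiv.mul_apply]; exact h.mul_conj (τ * σ), N, ?_⟩
  have h1 := map_isIntegral_int (σ : cmNumbers ≃ₐ[ℚ] cmNumbers).toAlgHom.toRingHom hN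
  rw [map_mul, map_pow, map_natCast] at h1
  exact h1

/-- `p ∈ ℤ ⊂ ℚ^{cm}` is an algebraic integer, and so are its powers. [folklore] -/
private theorem isIntegral_natCast_pow (k : ℕ) : IsIntegral ℤ ((p : cmNumbers) ^ k) := by
  rw [← map_natCast (algebraMap ℤ cmNumbers) p]
  exact isIntegral_algebraMap.pow k

/-- **`π⁻¹` is a Weil `pⁿ`-number of weight `+m`** (`π⁻¹ = ιπ/(pⁿ)^m`; `p^{N + n·m⁺} π⁻¹` is an algebraic integer).
[cite: Milne1999, §4 p. 59 L31 («the group of Weil pⁿ-numbers»)] -/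
theorem IsWeilNumber.inv (hp : p ≠ 0) (h : IsWeilNumber p n m π) : IsWeilNumber p n (-m) π⁻¹ := by
  have hπ := h.ne_zero hp
  have hq : ((p : cmNumbers) ^ n) ≠ 0 := pow_ne_zero n (Nat.cast_ne_zero.mpr hp)
  obtain ⟨N, hN⟩ := h.conj.exists_isIntegral
  obtain ⟨k, hk⟩ := Int.eq_ofNat_of_zero_le (show (0 : ℤ) ≤ (m.toNat : ℤ) - m by have := Int.self_le_toNat m; omega)
  refine isWeilNumber_iff.mpr ⟨?_, N + n * m.toNat, ?_⟩
  · rw [map_inv₀, ← mul_inv, h.mul_conj_self, zpow_neg]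
  · -- `π⁻¹ = ιπ · ((pⁿ)^m)⁻¹`
    have hinv : π⁻¹ = cmNumbersConj π * (((p : cmNumbers) ^ n) ^ m)⁻¹ :=
      inv_eq_of_mul_eq_one_right (by rw [← mul_assoc, h.mul_conj_self, mul_inv_cancel₀ (zpow_ne_zero m hq)])
    -- `p^{n m⁺} · ((pⁿ)^m)⁻¹ = (pⁿ)^{m⁺ − m} = p^{n k}`
    have haux : (p : cmNumbers) ^ (n * m.toNat) * (((p : cmNumbers) ^ n) ^ m)⁻¹ = (p : cmNumbers) ^ (n * k) := by
      rw [pow_mul, ← zpow_natCast ((p : cmNumbers) ^ n) m.toNat, ← zpow_neg, ← zpow_add₀ hq, ← sub_eq_add_neg, hk,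
        zpow_natCast, pow_mul]
    have hcalc : (p : cmNumbers) ^ (N + n * m.toNat) * π⁻¹ =
        ((p : cmNumbers) ^ N * cmNumbersConj π) * ((p : cmNumbers) ^ (n * m.toNat) * (((p : cmNumbers) ^ n) ^ m)⁻¹) := by
      rw [hinv, pow_add]; ring
    rw [hcalc, haux]
    exact hN.mul (isIntegral_natCast_pow (n * k))

/-- **`π^k` is a Weil `p^{nk}`-number of the same weight** («if `n | n′`, then `π ↦ π^{n′/n}` maps `W(pⁿ)` into `W(p^{n′})`»).
[cite: Milne1999, §4 p. 59 L31 – p. 60 L1] -/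
theorem IsWeilNumber.pow_level (h : IsWeilNumber p n m π) (k : ℕ) : IsWeilNumber p (n * k) m (π ^ k) := by
  obtain ⟨N, hN⟩ := h.exists_isIntegral
  refine isWeilNumber_iff.mpr ⟨?_, N * k, ?_⟩
  · rw [map_pow, ← mul_pow, h.mul_conj_self, pow_mul, ← zpow_natCast (((p : cmNumbers) ^ n) ^ m) k, ← zpow_mul,
      ← zpow_natCast ((p : cmNumbers) ^ n) k, ← zpow_mul, mul_comm m]
  · have : (p : cmNumbers) ^ (N * k) * π ^ k = ((p : cmNumbers) ^ N * π) ^ k := by rw [mul_pow, pow_mul]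
    rw [this]
    exact hN.pow k

/-- `π^k` is also a Weil `pⁿ`-number, of weight `−km`. [cite: Milne1999, §4 p. 59 L31] -/
theorem IsWeilNumber.pow (hp : p ≠ 0) (h : IsWeilNumber p n m π) (k : ℕ) : IsWeilNumber p n (k * m) (π ^ k) := by
  induction k with
  | zero => simpa using (IsWeilNumber.one : IsWeilNumber p n 0 (1 : cmNumbers))
  | succ k ih =>
    rw [pow_succ, Nat.cast_succ, add_mul, one_mul]
    exact ih.mul hp h

/-- **Roots of unity are Weil `pⁿ`-numbers of weight `0`** (`|ζ| = 1`, `ζ` an algebraic integer).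
[cite: Milne1999, §4 p. 60 L4–L6 («differ by a root of unity»)] -/
theorem IsWeilNumber.of_pow_eq_one {ζ : cmNumbers} {k : ℕ} (hk : k ≠ 0) (hζ : ζ ^ k = 1) : IsWeilNumber p n 0 ζ := by
  refine isWeilNumber_iff.mpr ⟨?_, 0, ?_⟩
  · apply Subtype.ext
    have hζ' : ((ζ : cmNumbers) : ℂ) ^ k = 1 := by
      have := congrArg (fun x : cmNumbers => (x : ℂ)) hζ
      simpa using this
    have h1 : ‖((ζ : cmNumbers) : ℂ)‖ = 1 := Complex.norm_eq_one_of_pow_eq_one hζ' hk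
    rw [zpow_zero]
    change ((ζ : cmNumbers) : ℂ) * conj ((ζ : cmNumbers) : ℂ) = 1
    rw [Complex.mul_conj', h1]
    norm_num
  · rw [pow_zero, one_mul]
    exact IsIntegral.of_pow (Nat.pos_of_ne_zero hk) (by rw [hζ]; exact isIntegral_one)

/-- **`pⁿ ∈ W(pⁿ)` with weight `−2`** (`pⁿ · pⁿ = (pⁿ)²`). [cite: Milne1999, §4 p. 59 L25–L28] -/
theorem IsWeilNumber.natCast_pow : IsWeilNumber p n 2 ((p : cmNumbers) ^ n) := by
  refine isWeilNumber_iff.mpr ⟨?_, 0, by rw [pow_zero, one_mul]; exact isIntegral_natCast_pow n⟩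
  rw [map_pow, map_natCast, zpow_two]

/-- **`p ∈ W(p²)` with weight `−1`** (`p · p = (p²)¹` — the Weil number of a supersingular elliptic curve over `𝔽_{p²}`).
[cite: Milne1999, §4 p. 59 L25–L28] -/
theorem IsWeilNumber.natCast_prime_sq : IsWeilNumber p 2 1 (p : cmNumbers) := by
  refine isWeilNumber_iff.mpr ⟨?_, 0, by rw [pow_zero, one_mul, ← pow_one (p : cmNumbers)]; exact isIntegral_natCast_pow 1⟩
  rw [map_natCast, zpow_one, sq]

/-! #### «Therefore `ℚ[π]` is either a CM-field or is totally real»: Weil numbers of `ℂ` lie in `ℚ^{cm}` -/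

/-- **A Weil `pⁿ`-number of ANY weight in `ℂ` is a CM number**: an algebraic `z ∈ ℂ` with `σ(z)·\overline{σ(z)} = (pⁿ)^m` for
every `σ ∈ Aut(ℂ)` (= for every embedding of `ℚ[z]`) lies in `ℚ^{cm}` — for `m ≥ 0` this is the tree's weight-`−1` argument
(`WeilNumber.mem_cmNumbers` with `q = p^{nm}`), for `m < 0` applied to `z⁻¹`. [cite: Milne1999, §4 p. 59 L28–L30] -/
theorem mem_cmNumbers_of_forall_mul_conj_eq (hp : p ≠ 0) {z : ℂ} (hz : IsAlgebraic ℚ z)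
    (hW : ∀ σ : ℂ ≃+* ℂ, σ z * conj (σ z) = ((p : ℂ) ^ n) ^ m) : z ∈ cmNumbers := by
  -- the norm form: `‖σ z‖ = √((pⁿ)^m)` with `(pⁿ)^m` a positive real
  have hnorm : ∀ σ : ℂ ≃+* ℂ, ‖σ z‖ ^ 2 = ((p : ℝ) ^ n) ^ m := fun σ => by
    have h1 : ((‖σ z‖ : ℂ) ^ 2) = (((p : ℝ) : ℂ) ^ n) ^ m := by
      rw [← Complex.mul_conj', hW σ, Complex.ofReal_natCast]
    exact_mod_cast h1
  rcases le_or_gt 0 m with hm | hm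
  · -- `m ≥ 0`: `z` is a Weil `q`-number with `q = p^{n m} ∈ ℕ`
    obtain ⟨k, rfl⟩ := Int.eq_ofNat_of_zero_le hm
    have hq : 0 < p ^ (n * k) := pow_pos (Nat.pos_of_ne_zero hp) _
    refine Literature.NumberTheory.NumberFields.WeilNumber.mem_cmNumbers hq hz fun σ => ?_
    have h2 : ‖σ z‖ ^ 2 = ((p ^ (n * k) : ℕ) : ℝ) := by
      rw [hnorm σ, zpow_natCast, ← pow_mul]; push_cast; rfl
    rw [← Real.sqrt_sq (norm_nonneg _), h2]
  · -- `m < 0`: `z⁻¹` is a Weil `q`-number with `q = p^{n |m|}`, and `ℚ^{cm}` is a field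
    obtain ⟨k, hk⟩ := Int.eq_ofNat_of_zero_le (show (0 : ℤ) ≤ -m by omega)
    have hq : 0 < p ^ (n * k) := pow_pos (Nat.pos_of_ne_zero hp) _
    have hz0 : z ≠ 0 := by
      intro h0
      have h1 := hnorm (RingEquiv.refl ℂ)
      rw [h0] at h1
      simp only [RingEquiv.refl_apply, norm_zero, ne_eq, OfNat.ofNat_ne_zero, not_false_eq_true, zero_pow] at h1
      exact (zpow_ne_zero m (pow_ne_zero n (Nat.cast_ne_zero.mpr hp : (p : ℝ) ≠ 0))) h1.symm
    have hinv : z⁻¹ ∈ cmNumbers := by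
      refine Literature.NumberTheory.NumberFields.WeilNumber.mem_cmNumbers hq hz.inv fun σ => ?_
      have h2 : ‖σ z⁻¹‖ ^ 2 = ((p ^ (n * k) : ℕ) : ℝ) := by
        rw [map_inv₀, norm_inv, inv_pow, hnorm σ, ← zpow_neg, hk, zpow_natCast, ← pow_mul]; push_cast; rfl
      rw [← Real.sqrt_sq (norm_nonneg _), h2]
    simpa using inv_mem hinv

/-- **«Therefore `ℚ[π]` is either a CM-field or is totally real»** — for such a `z ∈ ℂ` (hence for every Weil `pⁿ`-number of
`ℚ^{cm}`, `z = π`). [cite: Milne1999, §4 p. 59 L28–L30] -/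
theorem isTotallyReal_or_isCMField_adjoin (hp : p ≠ 0) {z : ℂ} (hz : IsIntegral ℚ z)
    (hW : ∀ σ : ℂ ≃+* ℂ, σ z * conj (σ z) = ((p : ℂ) ^ n) ^ m) :
    NumberField.IsTotallyReal ℚ⟮z⟯ ∨ NumberField.IsCMField ℚ⟮z⟯ :=
  (mem_cmNumbers_iff_adjoin hz).mp (mem_cmNumbers_of_forall_mul_conj_eq hp hz.isAlgebraic hW)

/-- For `π ∈ ℚ^{cm}` itself: `ℚ(π)` is totally real or CM (every element of `ℚ^{cm}` generates such a field).
[cite: Milne1999, §4 p. 59 L28–L30] [cite: MilneCM2006, Ch. I §1 Rem. 1.6 (p. 10)] -/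
theorem IsWeilNumber.isTotallyReal_or_isCMField_adjoin (_h : IsWeilNumber p n m π) :
    NumberField.IsTotallyReal ℚ⟮(π : ℂ)⟯ ∨ NumberField.IsCMField ℚ⟮(π : ℂ)⟯ :=
  (mem_cmNumbers_iff_adjoin (Literature.NumberTheory.NumberFields.isIntegral_of_mem_cmNumbers π.2)).mp π.2

/-- **A Weil `pⁿ`-number of `ℂ` (conditions (a) over all `σ ∈ Aut(ℂ)` and (b)) IS a Weil `pⁿ`-number of `ℚ^{cm}`** — the
passage from Milne's `W(pⁿ) ⊂ ℚ^{al}` to this file's carrier `ℚ^{cm}`. [cite: Milne1999, §4 p. 59 L25–L31] -/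
theorem isWeilNumber_of_forall_ringEquiv (hp : p ≠ 0) {z : ℂ} (hz : IsAlgebraic ℚ z)
    (hW : ∀ σ : ℂ ≃+* ℂ, σ z * conj (σ z) = ((p : ℂ) ^ n) ^ m)
    (hb : ∃ N : ℕ, IsIntegral ℤ ((p : ℂ) ^ N * z)) :
    IsWeilNumber p n m ⟨z, mem_cmNumbers_of_forall_mul_conj_eq hp hz hW⟩ := by
  obtain ⟨N, hN⟩ := hb
  refine isWeilNumber_iff.mpr ⟨?_, N, ?_⟩
  · apply (algebraMap cmNumbers ℂ).injective
    rw [map_mul, map_zpow₀, map_pow, map_natCast]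
    simpa using hW (RingEquiv.refl ℂ)
  · -- integrality is detected in `ℂ` (the inclusion `ℚ^{cm} ⊂ ℂ` is injective)
    rw [isIntegral_iff_coe]
    exact hN

/-! ### §2 The group `W(pⁿ)` of Weil `pⁿ`-numbers, weights, and the `Γ`-action -/

section Group

variable (p n : ℕ) [hp : Fact p.Prime]

/-- **`W(pⁿ)`, the group of Weil `pⁿ`-numbers** (of all weights) inside `(ℚ^{cm})ˣ` («Let `W(pⁿ)` be the group of Weil
`pⁿ`-numbers in `ℚ^{al}`» — they all lie in `ℚ^{cm}`, `mem_cmNumbers_of_forall_mul_conj_eq`). [cite: Milne1999, §4 p. 59 L31] -/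
def weilGroup : Subgroup cmNumbersˣ where
  carrier := {u | ∃ m : ℤ, IsWeilNumber p n m (u : cmNumbers)}
  one_mem' := ⟨0, by rw [Units.val_one]; exact IsWeilNumber.one⟩
  mul_mem' := by
    rintro u v ⟨m, hm⟩ ⟨m', hm'⟩
    exact ⟨m + m', by rw [Units.val_mul]; exact hm.mul hp.out.ne_zero hm'⟩
  inv_mem' := by
    rintro u ⟨m, hm⟩
    exact ⟨-m, by rw [Units.val_inv_eq_inv_val]; exact hm.inv hp.out.ne_zero⟩

variable {p n}

/-- Membership in `W(pⁿ)`: some weight `−m`. [cite: Milne1999, §4 p. 59 L25–L31] -/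
theorem mem_weilGroup_iff (u : cmNumbersˣ) : u ∈ weilGroup p n ↔ ∃ m : ℤ, IsWeilNumber p n m (u : cmNumbers) := Iff.rfl

/-- A Weil `pⁿ`-number `π` as an element of `W(pⁿ)` (it is a unit of `ℚ^{cm}`). [cite: Milne1999, §4 p. 59 L25–L31] -/
def weilGroup.ofIsWeilNumber (h : IsWeilNumber p n m π) : weilGroup p n :=
  ⟨Units.mk0 π (h.ne_zero hp.out.ne_zero), m, h⟩

/-- [cite: Milne1999, §4 p. 59 L25–L31] -/
@[simp] theorem weilGroup.coe_ofIsWeilNumber (h : IsWeilNumber p n m π) :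
    ((weilGroup.ofIsWeilNumber h : weilGroup p n) : cmNumbersˣ) = Units.mk0 π (h.ne_zero hp.out.ne_zero) := rfl

/-- **The weight exponent `m` of `u ∈ W(pⁿ)`** (Milne's weight is `−m`; a choice, unique by `weilExp_eq` once `n ≠ 0`).
[cite: Milne1999, §4 p. 59 L25–L27] -/
def weilExp (u : weilGroup p n) : ℤ := Classical.choose u.2

/-- `u` is a Weil `pⁿ`-number of weight `−weilExp u`. [cite: Milne1999, §4 p. 59 L25–L27] -/
theorem isWeilNumber_weilExp (u : weilGroup p n) : IsWeilNumber p n (weilExp u) ((u : cmNumbersˣ) : cmNumbers) :=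
  Classical.choose_spec u.2

/-- **The weight is well defined** (`n ≠ 0`). [cite: Milne1999, §4 p. 59 L25–L27] -/
theorem weilExp_eq [NeZero n] {u : weilGroup p n} {m : ℤ} (h : IsWeilNumber p n m ((u : cmNumbersˣ) : cmNumbers)) :
    weilExp u = m :=
  (isWeilNumber_weilExp u).unique hp.out.one_lt (NeZero.ne n) h

/-- `u · ιu = (pⁿ)^{weilExp u}`. [cite: Milne1999, §4 p. 59 L25–L27] -/
theorem val_mul_conj_eq_zpow_weilExp (u : weilGroup p n) :
    ((u : cmNumbersˣ) : cmNumbers) * cmNumbersConj ((u : cmNumbersˣ) : cmNumbers) = ((p : cmNumbers) ^ n) ^ weilExp u :=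
  (isWeilNumber_weilExp u).mul_conj_self

/-- Weights add. [cite: Milne1999, §4 p. 59 L31] -/
theorem weilExp_mul [NeZero n] (u v : weilGroup p n) : weilExp (u * v) = weilExp u + weilExp v :=
  weilExp_eq (by rw [Subgroup.coe_mul, Units.val_mul]
                 exact (isWeilNumber_weilExp u).mul hp.out.ne_zero (isWeilNumber_weilExp v))

/-- `weilExp 1 = 0`. [cite: Milne1999, §4 p. 59 L31] -/
theorem weilExp_one [NeZero n] : weilExp (1 : weilGroup p n) = 0 :=
  weilExp_eq (by rw [Subgroup.coe_one, Units.val_one]; exact IsWeilNumber.one)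

/-- `weilExp u⁻¹ = −weilExp u`. [cite: Milne1999, §4 p. 59 L31] -/
theorem weilExp_inv [NeZero n] (u : weilGroup p n) : weilExp u⁻¹ = -weilExp u :=
  weilExp_eq (by rw [Subgroup.coe_inv, Units.val_inv_eq_inv_val]; exact (isWeilNumber_weilExp u).inv hp.out.ne_zero)

variable (p n) in
/-- **The weight homomorphism `W(pⁿ) → ℤ`, `u ↦ weilExp u`** (Milne's weight is its negative). [cite: Milne1999, §4 p. 59 L25–L31] -/
def weilExpHom [NeZero n] : weilGroup p n →* Multiplicative ℤ where
  toFun u := Multiplicative.ofAdd (weilExp u)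
  map_one' := by rw [weilExp_one]; rfl
  map_mul' u v := by rw [weilExp_mul, ofAdd_add]

/-- [cite: Milne1999, §4 p. 59 L25–L31] -/
@[simp] theorem weilExpHom_apply [NeZero n] (u : weilGroup p n) : weilExpHom p n u = Multiplicative.ofAdd (weilExp u) := rfl

/-- `W(pⁿ)` is stable under `Γ = Gal(ℚ^{cm}/ℚ)`. [cite: Milne1999, §4 p. 60 L8–L9 («a natural action of Γ»)] -/
theorem map_mem_weilGroup (σ : cmNumbers ≃ₐ[ℚ] cmNumbers) {u : cmNumbersˣ} (hu : u ∈ weilGroup p n) :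
    Units.map (σ : cmNumbers →* cmNumbers) u ∈ weilGroup p n := by
  obtain ⟨m, hm⟩ := hu
  exact ⟨m, hm.smul σ⟩

variable (p n) in
/-- **The action of `σ ∈ Γ` on `W(pⁿ)`** (restriction of `σ` to the `Γ`-stable subgroup `W(pⁿ) ≤ (ℚ^{cm})ˣ`).
[cite: Milne1999, §4 p. 60 L8–L9] -/
def weilAct (σ : cmNumbers ≃ₐ[ℚ] cmNumbers) : weilGroup p n →* weilGroup p n :=
  ((Units.map (σ : cmNumbers →* cmNumbers)).restrict (weilGroup p n)).codRestrict (weilGroup p n)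
    fun u => map_mem_weilGroup σ u.2

/-- Values of the action: `(σ·u) = σ(u)` in `ℚ^{cm}`. [cite: Milne1999, §4 p. 60 L8–L9] -/
@[simp] theorem coe_weilAct (σ : cmNumbers ≃ₐ[ℚ] cmNumbers) (u : weilGroup p n) :
    (((weilAct p n σ u : weilGroup p n) : cmNumbersˣ) : cmNumbers) = σ ((u : cmNumbersˣ) : cmNumbers) := rfl

/-- `1 ∈ Γ` acts trivially. [cite: Milne1999, §4 p. 60 L8–L9] -/
theorem weilAct_one (u : weilGroup p n) : weilAct p n 1 u = u :=
  Subtype.ext (Units.ext rfl)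

/-- `(στ)·u = σ·(τ·u)`. [cite: Milne1999, §4 p. 60 L8–L9] -/
theorem weilAct_mul (σ τ : cmNumbers ≃ₐ[ℚ] cmNumbers) (u : weilGroup p n) :
    weilAct p n (σ * τ) u = weilAct p n σ (weilAct p n τ u) :=
  Subtype.ext (Units.ext rfl)

variable (p n) in
/-- **`W(pⁿ)` as a `Γ`-MODULE**: the representation of `Γ = Gal(ℚ^{cm}/ℚ)` on the additive group underlying `W(pⁿ)` (the shape in
which `X^*(P) = W(p^∞)` is consumed by the tree's torus-by-character-module functor `torusPoints`).
[cite: Milne1999, §4 p. 60 L8–L10 («a natural action of Γ on W(p^∞), and the Weil-number torus P … X^*(P) = W(p^∞)»)] -/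
def weilRep : Representation ℤ (cmNumbers ≃ₐ[ℚ] cmNumbers) (Additive (weilGroup p n)) where
  toFun σ := (MonoidHom.toAdditive (weilAct p n σ)).toIntLinearMap
  map_one' := LinearMap.ext fun u => by
    change Additive.ofMul (weilAct p n 1 (Additive.toMul u)) = u
    rw [weilAct_one]; rfl
  map_mul' σ τ := LinearMap.ext fun u => by
    change Additive.ofMul (weilAct p n (σ * τ) (Additive.toMul u)) =
      Additive.ofMul (weilAct p n σ (Additive.toMul (Additive.ofMul (weilAct p n τ (Additive.toMul u)))))
    rw [weilAct_mul]; rfl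

/-- `weilRep σ` is `weilAct σ` read additively. [cite: Milne1999, §4 p. 60 L8–L10] -/
@[simp] theorem weilRep_apply (σ : cmNumbers ≃ₐ[ℚ] cmNumbers) (u : Additive (weilGroup p n)) :
    weilRep p n σ u = Additive.ofMul (weilAct p n σ (Additive.toMul u)) := rfl

/-- **Weights are `Γ`-invariant**: `weilExp (σ·u) = weilExp u`. [cite: Milne1999, §4 p. 60 L8–L9] -/
theorem weilExp_weilAct [NeZero n] (σ : cmNumbers ≃ₐ[ℚ] cmNumbers) (u : weilGroup p n) :
    weilExp (weilAct p n σ u) = weilExp u :=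
  weilExp_eq (by rw [coe_weilAct]; exact (isWeilNumber_weilExp u).smul σ)

/-- **Complex conjugation acts on `W(pⁿ)` as `u ↦ (pⁿ)^m u⁻¹`** («`π ↦ p^{nm}/π` defines an involution `ι′` … `ρ ∘ ι′ = ι ∘ ρ`»).
[cite: Milne1999, §4 p. 59 L28–L30] -/
theorem coe_weilAct_cmNumbersConj (u : weilGroup p n) :
    (((weilAct p n cmNumbersConj u : weilGroup p n) : cmNumbersˣ) : cmNumbers) =
      ((p : cmNumbers) ^ n) ^ weilExp u / ((u : cmNumbersˣ) : cmNumbers) := by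
  rw [coe_weilAct]
  exact (isWeilNumber_weilExp u).conj_eq_div hp.out.ne_zero

end Group

/-! ### §3 The transition maps `W(pⁿ) → W(p^{n′})`, `π ↦ π^{n′/n}` for `n ∣ n′` -/

section Transition

variable {p : ℕ} [hp : Fact p.Prime] {n n' n'' : ℕ}

/-- `u^k ∈ W(p^{nk})` for `u ∈ W(pⁿ)`. [cite: Milne1999, §4 p. 59 L31 – p. 60 L1] -/
theorem pow_mem_weilGroup_mul {u : cmNumbersˣ} (hu : u ∈ weilGroup p n) (k : ℕ) : u ^ k ∈ weilGroup p (n * k) := by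
  obtain ⟨m, hm⟩ := hu
  exact ⟨m, by rw [Units.val_pow_eq_pow_val]; exact hm.pow_level k⟩

/-- **The transition map `W(pⁿ) → W(p^{n′})`, `π ↦ π^{n′/n}`, for `n ∣ n′`** («If `n | n′`, then `π ↦ π^{n′/n}` maps `W(pⁿ)` into
`W(p^{n′})`»). [cite: Milne1999, §4 p. 59 L31 – p. 60 L1] -/
def weilTransition (h : n ∣ n') : weilGroup p n →* weilGroup p n' where
  toFun u := ⟨(u : cmNumbersˣ) ^ (n' / n), by
    have hm := pow_mem_weilGroup_mul u.2 (n' / n)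
    rwa [Nat.mul_div_cancel' h] at hm⟩
  map_one' := Subtype.ext (by
    change ((1 : weilGroup p n) : cmNumbersˣ) ^ (n' / n) = 1
    rw [Subgroup.coe_one, one_pow])
  map_mul' u v := Subtype.ext (by
    change ((u * v : weilGroup p n) : cmNumbersˣ) ^ (n' / n) = (u : cmNumbersˣ) ^ (n' / n) * (v : cmNumbersˣ) ^ (n' / n)
    rw [Subgroup.coe_mul, mul_pow])

/-- Values: `weilTransition h u = u^{n′/n}`. [cite: Milne1999, §4 p. 59 L31 – p. 60 L1] -/
@[simp] theorem coe_weilTransition (h : n ∣ n') (u : weilGroup p n) :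
    ((weilTransition h u : weilGroup p n') : cmNumbersˣ) = (u : cmNumbersˣ) ^ (n' / n) := rfl

/-- **The transition maps preserve the weight.** [cite: Milne1999, §4 p. 59 L31 – p. 60 L1] -/
theorem weilExp_weilTransition [NeZero n'] (h : n ∣ n') (u : weilGroup p n) :
    weilExp (weilTransition h u) = weilExp u := by
  refine weilExp_eq ?_
  have h1 := (isWeilNumber_weilExp u).pow_level (n' / n)
  rw [Nat.mul_div_cancel' h] at h1
  rw [coe_weilTransition, Units.val_pow_eq_pow_val]
  exact h1

/-- **The transition maps are `Γ`-equivariant.** [cite: Milne1999, §4 p. 60 L8–L9] -/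
theorem weilTransition_weilAct (h : n ∣ n') (σ : cmNumbers ≃ₐ[ℚ] cmNumbers) (u : weilGroup p n) :
    weilTransition h (weilAct p n σ u) = weilAct p n' σ (weilTransition h u) :=
  Subtype.ext (Units.ext (by simp [Units.val_pow_eq_pow_val, map_pow]))

/-- `weilTransition (n ∣ n) = id` (`n ≠ 0`). [cite: Milne1999, §4 p. 60 L1 («W(p^∞) = lim→ W(pⁿ)»)] -/
theorem weilTransition_refl [NeZero n] (u : weilGroup p n) : weilTransition (dvd_refl n) u = u :=
  Subtype.ext (by rw [coe_weilTransition, Nat.div_self (Nat.pos_of_ne_zero (NeZero.ne n)), pow_one])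

/-- **Transitivity `W(pⁿ) → W(p^{n′}) → W(p^{n″})`**: `(u^{n′/n})^{n″/n′} = u^{n″/n}` — the `W(pⁿ)` form a DIRECTED SYSTEM along
divisibility (the system whose limit is `W(p^∞)`). [cite: Milne1999, §4 p. 60 L1 («W(p^∞) = lim→ W(pⁿ)»)] -/
theorem weilTransition_trans [NeZero n] [NeZero n'] (h : n ∣ n') (h' : n' ∣ n'') (u : weilGroup p n) :
    weilTransition h' (weilTransition h u) = weilTransition (h.trans h') u := by
  refine Subtype.ext ?_
  rw [coe_weilTransition, coe_weilTransition, coe_weilTransition, ← pow_mul]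
  congr 1
  obtain ⟨a, rfl⟩ := h
  obtain ⟨b, rfl⟩ := h'
  have hn : 0 < n := Nat.pos_of_ne_zero (NeZero.ne n)
  have hna : 0 < n * a := Nat.pos_of_ne_zero (NeZero.ne (n * a))
  rw [Nat.mul_div_cancel_left a hn, Nat.mul_div_cancel_left b hna, mul_assoc, Nat.mul_div_cancel_left (a * b) hn]

/-- **The printed equivalence at finite level**: `u ∈ W(pⁿ)` and `u′ ∈ W(p^{n′})` have the same image in `W(p^{nn′})` iff
`u^{n′} = u′^{n}` («`π ∈ W(pⁿ)` and `π′ ∈ W(p^{n′})` represent the same element of `W(p^∞)` if and only if `π^{n′}` and `π′^{n}`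
differ by a root of unity» — the root of unity appears only at the limit). [cite: Milne1999, §4 p. 60 L2–L6] -/
theorem weilTransition_eq_weilTransition_iff [NeZero n] [NeZero n'] (u : weilGroup p n) (u' : weilGroup p n') :
    weilTransition (Dvd.intro n' rfl : n ∣ n * n') u = weilTransition (Dvd.intro_left n rfl : n' ∣ n * n') u' ↔
      (u : cmNumbersˣ) ^ n' = (u' : cmNumbersˣ) ^ n := by
  rw [Subtype.ext_iff, coe_weilTransition, coe_weilTransition,
    Nat.mul_div_cancel_left n' (Nat.pos_of_ne_zero (NeZero.ne n)), Nat.mul_div_cancel n (Nat.pos_of_ne_zero (NeZero.ne n'))]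

end Transition

/-! ### §4 `W_{1,+}(pⁿ)`: weight `−1` and algebraic integers -/

section OnePlus

variable (p n : ℕ) [hp : Fact p.Prime]

/-- **`W_{1,+}(pⁿ) ⊆ W(pⁿ)`**: «those `π` that are of weight `−1` and are algebraic integers».
[cite: Milne1999, §4 p. 60 L11–L12] -/
def weilOnePlus : Set (weilGroup p n) :=
  {u | IsWeilNumber p n 1 ((u : cmNumbersˣ) : cmNumbers) ∧ IsIntegral ℤ ((u : cmNumbersˣ) : cmNumbers)}

variable {p n}

/-- Membership in `W_{1,+}(pⁿ)`. [cite: Milne1999, §4 p. 60 L11–L12] -/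
theorem mem_weilOnePlus_iff (u : weilGroup p n) :
    u ∈ weilOnePlus p n ↔ IsWeilNumber p n 1 ((u : cmNumbersˣ) : cmNumbers) ∧ IsIntegral ℤ ((u : cmNumbersˣ) : cmNumbers) :=
  Iff.rfl

/-- Elements of `W_{1,+}(pⁿ)` have weight `−1`. [cite: Milne1999, §4 p. 60 L11–L12] -/
theorem weilExp_eq_one_of_mem_weilOnePlus [NeZero n] {u : weilGroup p n} (hu : u ∈ weilOnePlus p n) : weilExp u = 1 :=
  weilExp_eq hu.1

/-- **`W_{1,+}(pⁿ)` is `Γ`-stable.** [cite: Milne1999, §4 p. 60 L8–L12] -/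
theorem weilAct_mem_weilOnePlus (σ : cmNumbers ≃ₐ[ℚ] cmNumbers) {u : weilGroup p n} (hu : u ∈ weilOnePlus p n) :
    weilAct p n σ u ∈ weilOnePlus p n := by
  refine ⟨by rw [coe_weilAct]; exact hu.1.smul σ, ?_⟩
  rw [coe_weilAct]
  exact map_isIntegral_int (σ : cmNumbers ≃ₐ[ℚ] cmNumbers).toAlgHom.toRingHom hu.2

/-- **The transition maps carry `W_{1,+}(pⁿ)` into `W_{1,+}(p^{n′})`** («`W_{1,+}(p^∞) = lim→ W_{1,+}(pⁿ)`»).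
[cite: Milne1999, §4 p. 60 L11–L12] -/
theorem weilTransition_mem_weilOnePlus {n' : ℕ} (h : n ∣ n') {u : weilGroup p n} (hu : u ∈ weilOnePlus p n) :
    weilTransition h u ∈ weilOnePlus p n' := by
  have h1 := hu.1.pow_level (n' / n)
  rw [Nat.mul_div_cancel' h] at h1
  refine ⟨by rw [coe_weilTransition, Units.val_pow_eq_pow_val]; exact h1, ?_⟩
  rw [coe_weilTransition, Units.val_pow_eq_pow_val]
  exact hu.2.pow _

omit hp in
/-- **An element of `W_{1,+}(pⁿ)` is a Weil `pⁿ`-number in the sense of the tree's `WeilNumber` file**: `‖σ π‖ = √(pⁿ)` for EVERY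
automorphism `σ` of `ℂ` (the conjugates of `π` under `Aut(ℂ)` are its `Γ`-conjugates, `CMNumbers.galRestrict`).
[cite: Milne1999, §4 p. 59 L25–L27] [cite: Waterhouse1969, Ch. 2 p. 527] -/
theorem norm_ringEquiv_eq_sqrt_of_isWeilNumber_one {π : cmNumbers} (h : IsWeilNumber p n 1 π) (σ : ℂ ≃+* ℂ) :
    ‖σ (π : ℂ)‖ = Real.sqrt (p ^ n : ℕ) := by
  have h1 := (h.smul (galRestrict σ)).norm_coe_sq
  rw [coe_galRestrict_apply, zpow_one] at h1
  rw [← Real.sqrt_sq (norm_nonneg _), h1]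
  push_cast
  rfl

/-- Hence Waterhouse's structure theory applies BY NAME: **`ℚ(π)` is totally real (iff `π² = pⁿ`) or a CM field with
`π̄ = pⁿ/π`** — here the dichotomy (`WeilNumber.isTotallyReal_or_isCMField_adjoin`). [cite: Milne1999, §4 p. 59 L28–L30] [cite: Waterhouse1969, Ch. 2 p. 528] -/
theorem isTotallyReal_or_isCMField_adjoin_of_isWeilNumber_one [NeZero n] {π : cmNumbers} (h : IsWeilNumber p n 1 π) :
    NumberField.IsTotallyReal ℚ⟮(π : ℂ)⟯ ∨ NumberField.IsCMField ℚ⟮(π : ℂ)⟯ :=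
  Literature.NumberTheory.NumberFields.WeilNumber.isTotallyReal_or_isCMField_adjoin
    (pow_pos hp.out.pos n) (Literature.NumberTheory.NumberFields.isIntegral_of_mem_cmNumbers π.2)
    (norm_ringEquiv_eq_sqrt_of_isWeilNumber_one h)

/-- … and `ℚ(π)` is CM exactly when `π² ≠ pⁿ` (`WeilNumber.isCMField_adjoin_iff`). [cite: Waterhouse1969, Ch. 2 p. 528] -/
theorem isCMField_adjoin_iff_of_isWeilNumber_one [NeZero n] {π : cmNumbers} (h : IsWeilNumber p n 1 π) :
    NumberField.IsCMField ℚ⟮(π : ℂ)⟯ ↔ (π : ℂ) ^ 2 ≠ ((p ^ n : ℕ) : ℂ) :=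
  Literature.NumberTheory.NumberFields.WeilNumber.isCMField_adjoin_iff (pow_pos hp.out.pos n)
    (Literature.NumberTheory.NumberFields.isIntegral_of_mem_cmNumbers π.2) (norm_ringEquiv_eq_sqrt_of_isWeilNumber_one h)

end OnePlus

/-! ### §5 Validation: `1 + 2i ∈ W_{1,+}(5)`, `p ∈ W_{1,+}(p²)`, `pⁿ ∈ W(pⁿ)`, roots of unity -/

section Examples

/-- `5` is prime (for the example `W(5)`). [folklore] -/
private instance fact_prime_five : Fact (Nat.Prime 5) := ⟨by norm_num⟩

/-- `i² = −1` and `ι(i) = −i` in `ℚ^{cm}` (`CMNumbers.I = i`). [folklore] -/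
private theorem I_mul_I' : (I : cmNumbers) * I = -1 :=
  Subtype.ext (by simp)

/-- [folklore] -/
private theorem cmNumbersConj_I' : cmNumbersConj I = -I :=
  Subtype.ext (by rw [coe_cmNumbersConj, coe_I]; exact Complex.conj_I)

/-- `1 + 2i ∈ ℚ^{cm}` is an algebraic integer (so `1 + 2i` satisfies (b) with `N = 0` and the integrality clause of `W_{1,+}`).
[cite: Milne1999, §4 p. 60 L11–L12 («of weight −1 and are algebraic integers»)] -/
theorem isIntegral_one_add_two_mul_I : IsIntegral ℤ (1 + 2 * I : cmNumbers) := by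
  rw [isIntegral_iff_coe]
  have h2 : IsIntegral ℤ (2 : ℂ) := by simpa using isIntegral_natCast (B := ℂ) 2
  have h : ((1 + 2 * I : cmNumbers) : ℂ) = 1 + 2 * Complex.I := by
    change algebraMap cmNumbers ℂ (1 + 2 * I) = _
    rw [map_add, map_one, map_mul, map_ofNat]; rfl
  rw [h]
  exact isIntegral_one.add (h2.mul Complex.isIntegral_int_I)

/-- **`1 + 2i` is a Weil `5`-number of weight `−1`**: `(1 + 2i)(1 − 2i) = 5` (the Frobenius of an ordinary elliptic curve over
`𝔽₅`; `ℚ(1 + 2i) = ℚ(i)` is a CM field — a non-real instance of the definition). [cite: Milne1999, §4 p. 59 L25–L28] -/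
theorem isWeilNumber_one_add_two_mul_I : IsWeilNumber 5 1 1 (1 + 2 * I : cmNumbers) := by
  refine isWeilNumber_iff.mpr ⟨?_, 0, by rw [pow_zero, one_mul]; exact isIntegral_one_add_two_mul_I⟩
  rw [map_add, map_one, map_mul, map_ofNat, cmNumbersConj_I', zpow_one, pow_one]
  linear_combination (-4 : cmNumbers) * I_mul_I'

/-- `1 + 2i ∈ W_{1,+}(5)`. [cite: Milne1999, §4 p. 60 L11–L12] -/
theorem one_add_two_mul_I_mem_weilOnePlus :
    weilGroup.ofIsWeilNumber isWeilNumber_one_add_two_mul_I ∈ weilOnePlus 5 1 :=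
  ⟨isWeilNumber_one_add_two_mul_I, isIntegral_one_add_two_mul_I⟩

/-- `ℚ(1 + 2i)` is a CM field (`(1 + 2i)² = −3 + 4i ≠ 5`; Waterhouse's criterion through `isCMField_adjoin_iff_of_isWeilNumber_one`).
[cite: Waterhouse1969, Ch. 2 p. 528] -/
theorem isCMField_adjoin_one_add_two_mul_I : NumberField.IsCMField ℚ⟮(1 + 2 * Complex.I : ℂ)⟯ := by
  have h := (isCMField_adjoin_iff_of_isWeilNumber_one (n := 1) isWeilNumber_one_add_two_mul_I).mpr
  have hc : ((1 + 2 * I : cmNumbers) : ℂ) = 1 + 2 * Complex.I := by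
    change algebraMap cmNumbers ℂ (1 + 2 * I) = _
    rw [map_add, map_one, map_mul, map_ofNat]; rfl
  rw [hc] at h
  refine h ?_
  intro h2
  have h3 := congrArg Complex.im h2
  norm_num [Complex.ext_iff, sq] at h3

variable (p n : ℕ) [hp : Fact p.Prime]

/-- **`p ∈ W_{1,+}(p²)`** — the Weil `p²`-number of weight `−1` of a supersingular elliptic curve over `𝔽_{p²}` (`ℚ(p) = ℚ` is
totally real: «Thus real primes are uncommon»). [cite: Milne1999, §4 p. 59 L25–L28] [cite: Waterhouse1969, Ch. 2 p. 528] -/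
theorem natCast_mem_weilOnePlus_two :
    weilGroup.ofIsWeilNumber (IsWeilNumber.natCast_prime_sq (p := p)) ∈ weilOnePlus p 2 :=
  ⟨IsWeilNumber.natCast_prime_sq, by
    rw [weilGroup.coe_ofIsWeilNumber, Units.val_mk0, ← map_natCast (algebraMap ℤ cmNumbers) p]
    exact isIntegral_algebraMap⟩

/-- `pⁿ ∈ W(pⁿ)` (weight `−2`). [cite: Milne1999, §4 p. 59 L25–L31] -/
theorem natCast_pow_mem_weilGroup :
    Units.mk0 ((p : cmNumbers) ^ n) (pow_ne_zero n (Nat.cast_ne_zero.mpr hp.out.ne_zero)) ∈ weilGroup p n :=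
  ⟨2, IsWeilNumber.natCast_pow⟩

/-- Roots of unity lie in every `W(pⁿ)` (weight `0`). [cite: Milne1999, §4 p. 60 L4–L6] -/
theorem mem_weilGroup_of_pow_eq_one {u : cmNumbersˣ} {k : ℕ} (hk : k ≠ 0) (hu : u ^ k = 1) : u ∈ weilGroup p n :=
  ⟨0, IsWeilNumber.of_pow_eq_one hk (by rw [← Units.val_pow_eq_pow_val, hu, Units.val_one])⟩

/-- `W(pⁿ)` has elements of non-zero weight, so the weight homomorphism is non-trivial (anti-vacuity; `n ≠ 0`).
[cite: Milne1999, §4 p. 59 L25–L31] -/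
theorem weilExpHom_ne_one [NeZero n] : weilExpHom p n ≠ 1 := by
  intro h
  have h1 := congrArg (fun f : weilGroup p n →* Multiplicative ℤ => f ⟨_, natCast_pow_mem_weilGroup p n⟩) h
  simp only [weilExpHom_apply, MonoidHom.one_apply] at h1
  have h2 : weilExp (⟨_, natCast_pow_mem_weilGroup p n⟩ : weilGroup p n) = 2 := weilExp_eq IsWeilNumber.natCast_pow
  rw [h2] at h1
  exact absurd (congrArg Multiplicative.toAdd h1) (by decide)

end Examples

end CMNumbers

end Literature.NumberTheory.ComplexMultiplication

end
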